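import Summits.QuantumFields.YangMills.Theorems.SmallFieldWideningLargeFieldMassRefinementTailOfHeightTail
import Summits.QuantumFields.YangMills.Theorems.FibreConvexityTailHistoryTailOfTwoSided
import Summits.QuantumFields.YangMills.Theorems.CoarseStiffnessTailHistoryTailOfStiffness

/-!
# Route `SmallFieldWidening` — crux r3 `LargeFieldMassRefinementTail` (stmt-QuantumFields-22884) BY NAME from the cruxes of the two
# SIBLING TAIL ROUTES `FibreConvexityTail` (`TwoSidedTailL` ∧ `TowerTailL`) and `CoarseStiffnessTail` (`CappedCoarseStiffnessL`)
# (support file; width seat `ym-line-sfw-p2-w3` gen 20, line `birth` of lead `ym-line-sfw-p2`)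

WHY.  Every closer of r3 landed so far (`…OfHeightTail`, `…OfIntCoreRec`, `…OfOneRecord`, `…OfLaneRecords`, the skeleton's
`stub_avgTailPkg`) is fed by the (α)-lane of route `UnitScaleTilt` (the renormalisation-group records behind crux K2-L `HistoryTailL`,
stmt-QuantumFields-19936).  Since 2026-08-28 two further routes attack the SAME large-field tail with (α)-free levers, each through a
crux stated in the tree's per-plaquette vocabulary:
* `FibreConvexityTail` (fibre log-concavity + Herbst): `TwoSidedTailL` (stmt-QuantumFields-25567) and `TowerTailL` (stmt-QuantumFields-25568)
  bound the FINEST-BAD-LEVEL event of one level-`j` averaged plaquette (all finer levels small), split by the status of the conditioner two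
  levels up, by `C·β_{K−j}^A·e^{−c·p(g_{K−j})²}` for `1 ≤ j`, `j + 2 ≤ K`, constants depending on `(F, γ)` only;
* `CoarseStiffnessTail` (one capped tilted partition function per level): `CappedCoarseStiffnessL` (stmt-QuantumFields-25301).
Their landed glues (`fibreConvexityTail_historyTailOfTwoSided_proof`, `historyTailOfStiffness_proof`) conclude `HistoryTailAt F γ b₀ p₀ m` —
the K2-L body with a `K`-PROPORTIONAL free top fraction `⌊K/m⌋`, which does NOT give r3 (r3 is the `m`-free core: a bound UNIFORM in the
run with a FIXED number `n` of free top steps, `δ n → 0`).  This file closes that gap: r3 follows from either route's crux(es) directly.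

THE ARGUMENT.
§1 (`real_compl_histGood_le_of_bare_finestBad`) ONE RUN WITH `n ≥ 2` FIXED FREE TOP STEPS: by the finest-bad-level decomposition of
   `HistoryTailOfTwoSided` (§1 there, [Balaban1985UV3] (7) p.257 organised by the first large scale),
   `Gibbs_K((histGood K n)ᶜ) ≤ q₀ K + Σ_{1 ≤ j ≤ K−n} q(K−j) ≤ q₀ K + Σ'_t q(t+n)` — the `j = 0` term is the bare event, every averaged
   height `j ≤ K − n ≤ K − 2` has its conditioner `j + 2 ≤ K`.
§2 (`gibbsK_refine_real_compl_histGood_le_of_bare_finestBad`) TRANSPORT: run `K` of `F.refine d` at `γL^{-d}` IS run `K + d` of `F` at `γ`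
   with `d` free top steps (landed `LargeFieldMassRefinementTailOfHeightTail.gibbsK_refine_real_compl_histGood`, thresholds shift by
   `θBal_mul_pow`), so for `d ≥ 2` its all-heights complement mass is `≤ Σ'_t q₀(t+d) + Σ'_t q(t+d)` UNIFORMLY IN `K`
   (`q₀(K+d) ≤ Σ'_t q₀(t+d)` for a non-negative summable bare profile).
§3 (`exists_null_mass_bound_of_bare_finestBad`) ONE NULL SEQUENCE: with `n₀` the least admissible depth (`γL^{-n₀} ≤ γ₁`) and the
   profiles of the ONE family `F.refine n₀`, `δ n = 𝟙[n < n₀ + 2] + Σ'_t q₀(t + (n − n₀)) + Σ'_t q(t + (n − n₀)) → 0` bounds every run of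
   every admissible refinement (`refine_refine`; tails of summable series tend to `0`; r3 needs `δ → 0` only, no summability of `δ`).
§4 (`largeFieldMassRefinementTail_of_twoSidedTail_towerTail`) r3 ⇐ `TwoSidedTailL ∧ TowerTailL`: profile `b₀ = max bmin_T (max bmin_W 1)`,
   `p₀ = 3`, `γ₁ = min γ_T γ_W ≤ 1`; for the one family `F.refine n` at `γL^{-n} ≤ γ₁` the bare profile is the tree theorem
   `T3BareTailProfile.bareTailAt` (reflection positivity + chessboard), the finest-bad-level profile is geometric by the union over the
   level-`j` plaquettes split by the conditioner (`real_not_plaqSmall_inter_le_sum_split`) and the tree arithmetic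
   `T3AveragedTailProfile.perHeight_bound` (`exists_perHeight_bound`, `level_arith`) — verbatim the one-height step of the landed glue.
§5 (`largeFieldMassRefinementTail_of_cappedCoarseStiffness`) r3 ⇐ `CappedCoarseStiffnessL`: the landed `perPlaquette_of_cappedStiffness`
   (chessboard + exponential Chebyshev) gives the plain per-plaquette schema with `(F, γ)`-dependent constants, which is the hypothesis of
   the landed `largeFieldMassRefinementTail_of_perPlaquette` at the profile `(b₀, p₀) = (1, 3)`.

WHAT THIS IS NOT: no large-field estimate is proved here — `TwoSidedTailL`, `TowerTailL`, `CappedCoarseStiffnessL` are OPEN cruxes (XL) of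
their routes, exactly as the (α)-records are; this file only wires r3 to them, so that r3 closes BY NAME the hour either sibling route's
tail crux(es) close, by the 3-line file `theorem … : …LargeFieldMassRefinementTail := largeFieldMassRefinementTail_of_twoSidedTail_towerTail ‹T› ‹W›`
(resp. `…_of_cappedCoarseStiffness ‹S›`).  Nothing here bears on the Yang–Mills mass gap; the rung R3 (`YM3TorusSU2`) is a RECORD rung and
stays open.

References: T. Bałaban, CMP 102 (1985) 255–275 [Balaban1985UV3] ((1)–(3) p.256, (7) p.257, (71) p.273); J. Fröhlich, R. Israel, E. Lieb,
B. Simon, CMP 62 (1978) 1–34 [FrohlichIsraelLiebSimon1978] (chessboard estimate behind the bare term and the stiffness lane).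
-/

noncomputable section

open MeasureTheory Filter Topology
open Literature.MathematicalPhysics.QuantumFieldTheory.Balaban1983to89
open Literature.MathematicalPhysics.QuantumFieldTheory.Balaban1983to89.T3ContinuumYM3Torus
open Literature.MathematicalPhysics.QuantumFieldTheory.Balaban1983to89.T3UnitScaleTilt
open Literature.MathematicalPhysics.QuantumFieldTheory.Balaban1983to89.T3UnitLawDensityEML (ℰp measurableE_ℰp)
open Literature.MathematicalPhysics.QuantumFieldTheory.Balaban1983to89.T3BareTailProfile
open Literature.MathematicalPhysics.QuantumFieldTheory.Balaban1983to89.T3AveragedTailProfile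
open Summit.QuantumFields.YangMills.Theorems.HistoryTailOfTwoSided
open Summit.QuantumFields.YangMills.Theorems.LargeFieldMassRefinementTailOfHeightTail
open Summit.QuantumFields.YangMills.Theorems.CoarseStiffnessTailHistoryTailOfStiffness (perPlaquette_of_cappedStiffness)

namespace Summit.QuantumFields.YangMills.Theorems.LargeFieldMassRefinementTailOfTailRoutes

/-! ## §1 One run with a fixed number `n ≥ 2` of free top steps -/

section OneRun

/-- **ONE RUN, `n ≥ 2` FREE TOP STEPS**: a bare bound `Gibbs_K{¬PlaqSmall θ(K)} ≤ q₀ K` and a finest-bad-level profile `q ≥ 0`, `Σ q < ∞`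
(`Gibbs_K({¬PlaqSmall θ(K−j) (Ū^{j})} ∩ {∀ i < j, PlaqSmall θ(K−i) (Ū^{i})}) ≤ q(K−j)` for `1 ≤ j`, `j + 2 ≤ K`) give
`Gibbs_K((histGood K n)ᶜ) ≤ q₀ K + Σ'_t q(t+n)` for every `n ≥ 2` (for `K < n` the event is everything and the bound is trivial) —
the finest-bad-level decomposition with every constrained averaged height `j ≤ K − n` two levels below the top.
[cite: Balaban1985UV3, (7) p.257 and (71) p.273] -/
theorem real_compl_histGood_le_of_bare_finestBad (F : T3Family) {γ : ℝ} (hγ : 0 ≤ γ) (b₀ p₀ : ℝ) (q₀ q : ℕ → ℝ)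
    (hq₀0 : ∀ i, 0 ≤ q₀ i) (hq0 : ∀ i, 0 ≤ q i) (hq : Summable q)
    (hbare : ∀ K, (gibbsK F ℰp γ K).real {U | ¬ PlaqSmall (θBal F.L γ b₀ p₀ K) U} ≤ q₀ K)
    (hfb : ∀ K j, 1 ≤ j → j + 2 ≤ K → (gibbsK F ℰp γ K).real
      ({U | ¬ PlaqSmall (θBal F.L γ b₀ p₀ (K - j))
          (Averaging.iter (fun i => BlockAveraging.blockAvg (P := F.P K) (j := i) ℰp) j U)} ∩
        {U | ∀ i, i < j → PlaqSmall (θBal F.L γ b₀ p₀ (K - i))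
          (Averaging.iter (fun i' => BlockAveraging.blockAvg (P := F.P K) (j := i') ℰp) i U)}) ≤ q (K - j))
    {n : ℕ} (hn : 2 ≤ n) (K : ℕ) :
    (gibbsK F ℰp γ K).real (histGood F ℰp (θBal F.L γ b₀ p₀) K n)ᶜ ≤ q₀ K + ∑' t, q (t + n) := by
  classical
  have hT0 : 0 ≤ ∑' t, q (t + n) := tsum_nonneg fun _ => hq0 _
  haveI := isProbabilityMeasure_gibbsK F ℰp hγ K
  by_cases hnK : n ≤ K
  · refine (real_compl_histGood_le_sum_finestBad F ℰp (θBal F.L γ b₀ p₀) K n (gibbsK F ℰp γ K)).trans ?_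
    rw [Finset.sum_range_succ', add_comm]
    refine add_le_add ?_ ?_
    · exact (measureReal_mono Set.inter_subset_left (measure_ne_top _ _)).trans (hbare K)
    · calc ∑ j ∈ Finset.range (K - n), (gibbsK F ℰp γ K).real
            ({U | ¬ PlaqSmall (θBal F.L γ b₀ p₀ (K - (j + 1)))
                (Averaging.iter (fun i => BlockAveraging.blockAvg (P := F.P K) (j := i) ℰp) (j + 1) U)} ∩
              {U | ∀ i, i < j + 1 → PlaqSmall (θBal F.L γ b₀ p₀ (K - i))
                (Averaging.iter (fun i' => BlockAveraging.blockAvg (P := F.P K) (j := i') ℰp) i U)})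
          ≤ ∑ j ∈ Finset.range (K - n), q (K - (j + 1)) :=
            Finset.sum_le_sum fun j hj => hfb K (j + 1) (by omega)
              (by have := Finset.mem_range.mp hj; omega)
        _ = ∑ j ∈ Finset.range (K - n), q (j + n) := by
            rw [← Finset.sum_range_reflect (fun j => q (j + n)) (K - n)]
            refine Finset.sum_congr rfl fun j hj => ?_
            have := Finset.mem_range.mp hj
            show q (K - (j + 1)) = q (K - n - 1 - j + n)
            congr 1
            omega
        _ ≤ ∑' t, q (t + n) := ((summable_nat_add_iff n).mpr hq).sum_le_tsum _ fun _ _ => hq0 _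
  · rw [histGood_of_lt F ℰp (not_le.mp hnK), Set.compl_univ, measureReal_empty]
    exact add_nonneg (hq₀0 K) hT0

end OneRun

/-! ## §2 Transport: every run of the `d`-th refinement, `d ≥ 2`, uniformly in the run -/

section Transport

/-- **K-UNIFORM MASS BOUND FOR THE REFINED FAMILY**: under the hypotheses of §1 with `q₀ ≥ 0` summable, for every refinement depth `d ≥ 2`
and EVERY run `K` the Gibbs mass (family `F.refine d`, coupling `γL^{-d}`) of the complement of the all-heights small-field event is at most
`Σ'_t q₀(t+d) + Σ'_t q(t+d)` — run `K` of `F.refine d` is run `K + d` of `F` with `d` free top steps (`gibbsK_refine_real_compl_histGood`,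
thresholds `θ_{γL^{-d}}(i) = θ_γ(i+d)`), then §1 and `q₀(K+d) ≤ Σ'_t q₀(t+d)`. [cite: Balaban1985UV3, (1)-(3) p.256 and (7) p.257] -/
theorem gibbsK_refine_real_compl_histGood_le_of_bare_finestBad (F : T3Family) {γ : ℝ} (hγ : 0 ≤ γ) (b₀ p₀ : ℝ)
    (q₀ q : ℕ → ℝ) (hq₀0 : ∀ i, 0 ≤ q₀ i) (hq₀ : Summable q₀) (hq0 : ∀ i, 0 ≤ q i) (hq : Summable q)
    (hbare : ∀ K, (gibbsK F ℰp γ K).real {U | ¬ PlaqSmall (θBal F.L γ b₀ p₀ K) U} ≤ q₀ K)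
    (hfb : ∀ K j, 1 ≤ j → j + 2 ≤ K → (gibbsK F ℰp γ K).real
      ({U | ¬ PlaqSmall (θBal F.L γ b₀ p₀ (K - j))
          (Averaging.iter (fun i => BlockAveraging.blockAvg (P := F.P K) (j := i) ℰp) j U)} ∩
        {U | ∀ i, i < j → PlaqSmall (θBal F.L γ b₀ p₀ (K - i))
          (Averaging.iter (fun i' => BlockAveraging.blockAvg (P := F.P K) (j := i') ℰp) i U)}) ≤ q (K - j))
    {d : ℕ} (hd : 2 ≤ d) (K : ℕ) :
    (gibbsK (F.refine d) ℰp (γ * ((F.L : ℝ)⁻¹) ^ d) K).real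
        (histGood (F.refine d) ℰp (θBal (F.refine d).L (γ * ((F.L : ℝ)⁻¹) ^ d) b₀ p₀) K 0)ᶜ ≤
      (∑' t, q₀ (t + d)) + ∑' t, q (t + d) := by
  have hθ : θBal (F.refine d).L (γ * ((F.L : ℝ)⁻¹) ^ d) b₀ p₀ = fun i => θBal F.L γ b₀ p₀ (i + d) :=
    funext fun i => θBal_mul_pow F.L γ b₀ p₀ d i
  rw [hθ, gibbsK_refine_real_compl_histGood F ℰp measurableE_ℰp hγ (θBal F.L γ b₀ p₀) d K]
  refine (real_compl_histGood_le_of_bare_finestBad F hγ b₀ p₀ q₀ q hq₀0 hq0 hq hbare hfb hd (K + d)).trans ?_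
  refine add_le_add ?_ le_rfl
  have hs : Summable fun t => q₀ (t + d) := (summable_nat_add_iff d).mpr hq₀
  exact hs.le_tsum K fun t _ => hq₀0 (t + d)

end Transport

/-! ## §3 One null sequence for all runs of all admissible refinements -/

section Null

/-- **ONE NULL SEQUENCE FROM THE LEAST ADMISSIBLE REFINEMENT**: for a family `F` and `γ > 0`, if every admissible refinement `F.refine n`
(`γL^{-n} ≤ γ₁`) at `γL^{-n}` carries a summable non-negative bare profile and a summable non-negative finest-bad-level profile (§1), then
some `δ n → 0` bounds the all-heights complement masses of EVERY run `K` of `F.refine n` for every admissible `n` — `δ n = 𝟙[n < n₀+2] +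
Σ'_t q₀(t + (n−n₀)) + Σ'_t q(t + (n−n₀))` for the profiles of the least admissible depth `n₀` (only that one instance is used; `refine_refine`).
[cite: Balaban1985UV3, (7) p.257 and (71) p.273] -/
theorem exists_null_mass_bound_of_bare_finestBad (F : T3Family) {γ γ₁ b₀ p₀ : ℝ} (hγ : 0 < γ)
    (H : ∀ n : ℕ, γ * ((F.L : ℝ)⁻¹) ^ n ≤ γ₁ →
      ∃ q₀ q : ℕ → ℝ, (∀ i, 0 ≤ q₀ i) ∧ Summable q₀ ∧ (∀ i, 0 ≤ q i) ∧ Summable q ∧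
        (∀ K, (gibbsK (F.refine n) ℰp (γ * ((F.L : ℝ)⁻¹) ^ n) K).real
          {U | ¬ PlaqSmall (θBal (F.refine n).L (γ * ((F.L : ℝ)⁻¹) ^ n) b₀ p₀ K) U} ≤ q₀ K) ∧
        (∀ K j, 1 ≤ j → j + 2 ≤ K → (gibbsK (F.refine n) ℰp (γ * ((F.L : ℝ)⁻¹) ^ n) K).real
          ({U | ¬ PlaqSmall (θBal (F.refine n).L (γ * ((F.L : ℝ)⁻¹) ^ n) b₀ p₀ (K - j))
              (Averaging.iter (fun i => BlockAveraging.blockAvg (P := (F.refine n).P K) (j := i) ℰp) j U)} ∩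
            {U | ∀ i, i < j → PlaqSmall (θBal (F.refine n).L (γ * ((F.L : ℝ)⁻¹) ^ n) b₀ p₀ (K - i))
              (Averaging.iter (fun i' => BlockAveraging.blockAvg (P := (F.refine n).P K) (j := i') ℰp) i U)}) ≤
          q (K - j))) :
    ∃ δ : ℕ → ℝ, Tendsto δ atTop (𝓝 0) ∧ ∀ n K : ℕ, γ * ((F.L : ℝ)⁻¹) ^ n ≤ γ₁ →
      (gibbsK (F.refine n) ℰp (γ * ((F.L : ℝ)⁻¹) ^ n) K).real
        (histGood (F.refine n) ℰp (θBal (F.refine n).L (γ * ((F.L : ℝ)⁻¹) ^ n) b₀ p₀) K 0)ᶜ ≤ δ n := by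
  classical
  by_cases hex : ∃ n : ℕ, γ * ((F.L : ℝ)⁻¹) ^ n ≤ γ₁
  · have hn₀ : γ * ((F.L : ℝ)⁻¹) ^ Nat.find hex ≤ γ₁ := Nat.find_spec hex
    obtain ⟨q₀, q, hq₀0, hq₀, hq0, hq, hbare, hfb⟩ := H (Nat.find hex) hn₀
    have hL0 : (0 : ℝ) < F.L := by exact_mod_cast (zero_lt_one.trans F.hL.2)
    have hγ' : 0 ≤ γ * ((F.L : ℝ)⁻¹) ^ Nat.find hex := (mul_pos hγ (pow_pos (inv_pos.mpr hL0) _)).le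
    have hT₀0 : ∀ m, 0 ≤ ∑' t, q₀ (t + m) := fun m => tsum_nonneg fun _ => hq₀0 _
    have hT0 : ∀ m, 0 ≤ ∑' t, q (t + m) := fun m => tsum_nonneg fun _ => hq0 _
    refine ⟨fun n => (if n < Nat.find hex + 2 then (1 : ℝ) else 0) +
      ((∑' t, q₀ (t + (n - Nat.find hex))) + ∑' t, q (t + (n - Nat.find hex))), ?_, fun n K hle => ?_⟩
    · -- `δ n → 0`: the indicator is eventually `0`, the two tails of summable series tend to `0`
      have h1 : Tendsto (fun n : ℕ => if n < Nat.find hex + 2 then (1 : ℝ) else 0) atTop (𝓝 0) := by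
        refine tendsto_const_nhds.congr' ?_
        filter_upwards [eventually_ge_atTop (Nat.find hex + 2)] with n hn
        rw [if_neg (not_lt.mpr hn)]
      have h2 : Tendsto (fun n : ℕ => ∑' t, q₀ (t + (n - Nat.find hex))) atTop (𝓝 0) :=
        (tendsto_sum_nat_add q₀).comp (tendsto_sub_atTop_nat (Nat.find hex))
      have h3 : Tendsto (fun n : ℕ => ∑' t, q (t + (n - Nat.find hex))) atTop (𝓝 0) :=
        (tendsto_sum_nat_add q).comp (tendsto_sub_atTop_nat (Nat.find hex))
      simpa using h1.add (h2.add h3)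
    · have hn : Nat.find hex ≤ n := Nat.find_min' hex hle
      obtain ⟨d, rfl⟩ : ∃ d, n = Nat.find hex + d := ⟨n - Nat.find hex, by omega⟩
      have hdsub : Nat.find hex + d - Nat.find hex = d := Nat.add_sub_cancel_left _ _
      have hrest : 0 ≤ (∑' t, q₀ (t + d)) + ∑' t, q (t + d) := add_nonneg (hT₀0 d) (hT0 d)
      beta_reduce
      rw [hdsub]
      by_cases hd : d < 2
      · -- fewer than two free top steps: the trivial bound `1`
        rw [if_pos (by omega)]
        have hγn : 0 ≤ γ * ((F.L : ℝ)⁻¹) ^ (Nat.find hex + d) := (mul_pos hγ (pow_pos (inv_pos.mpr hL0) _)).le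
        haveI := isProbabilityMeasure_gibbsK (F.refine (Nat.find hex + d)) ℰp hγn K
        exact measureReal_le_one.trans (le_add_of_nonneg_right hrest)
      · rw [if_neg (by omega), zero_add]
        have hc : γ * ((F.L : ℝ)⁻¹) ^ (Nat.find hex + d) =
            γ * ((F.L : ℝ)⁻¹) ^ Nat.find hex * ((F.L : ℝ)⁻¹) ^ d := by rw [pow_add, mul_assoc]
        rw [hc, ← refine_refine F (Nat.find hex) d]
        exact gibbsK_refine_real_compl_histGood_le_of_bare_finestBad (F.refine (Nat.find hex)) hγ' b₀ p₀ q₀ q hq₀0 hq₀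
          hq0 hq hbare hfb (not_lt.mp hd) K
  · exact ⟨fun _ => 0, tendsto_const_nhds, fun n K hle => (hex ⟨n, hle⟩).elim⟩

end Null

/-! ## §4 r3 BY NAME from the two cruxes of route `FibreConvexityTail` -/

section FibreConvexity

/-- **r3 ⇐ `TwoSidedTailL ∧ TowerTailL`** (cruxes stmt-QuantumFields-25567 / 25568 of route `FibreConvexityTail`): the finest-bad-level tails
of one block-averaged plaquette with its conditioner two levels up SMALL (the fibre-convexity lever's case) resp. LARGE (the tower residual)
together give `LargeFieldMassRefinementTail` — at the profile `b₀ = max bmin_T (max bmin_W 1)`, `p₀ = 3`, threshold `γ₁ = min γ_T γ_W`; for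
the ONE family `F.refine n₀` at the least admissible depth the bare term is the tree theorem `bareTailAt` and the finest-bad-level profile is
geometric (union over plaquettes, split by the conditioner, `perHeight_bound`).  Neither crux is proved here; no rung or summit is proved.
[cite: Balaban1985UV3, (7) p.257 and (71) p.273] -/
theorem largeFieldMassRefinementTail_of_twoSidedTail_towerTail
    (hT : Summit.QuantumFields.YangMills.Theses.FibreConvexityTail.TwoSidedTailL)
    (hW : Summit.QuantumFields.YangMills.Theses.FibreConvexityTail.TowerTailL) :
    Summit.QuantumFields.YangMills.Theses.SmallFieldWidening.LargeFieldMassRefinementTail := by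
  intro L
  obtain ⟨bT, hbT⟩ := hT L
  obtain ⟨bW, hbW⟩ := hW L
  -- the profile above both thresholds and above `1`
  obtain ⟨b₀, hbT', hbW', hb₀1⟩ : ∃ b₀ : ℝ, bT ≤ b₀ ∧ bW ≤ b₀ ∧ 1 ≤ b₀ :=
    ⟨max bT (max bW 1), le_max_left _ _, le_max_of_le_right (le_max_left _ _),
      le_max_of_le_right (le_max_right _ _)⟩
  have hb₀ : 0 < b₀ := one_pos.trans_le hb₀1
  have hp₀ : (2 : ℝ) < 3 := by norm_num
  have hp₀1 : (1 : ℝ) ≤ 3 := by norm_num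
  obtain ⟨γT, hγT, hγT1, hTF⟩ := hbT b₀ 3 hbT' hb₀ hp₀
  obtain ⟨γW, hγW, -, hWF⟩ := hbW b₀ 3 hbW' hb₀ hp₀
  refine ⟨b₀, 3, min γT γW, hb₀, hp₀, lt_min hγT hγW, fun F γ hFL hγ => ?_⟩
  refine exists_null_mass_bound_of_bare_finestBad F hγ fun n hn => ?_
  -- the ONE family `F.refine n` at `γ' = γL^{-n} ≤ min γ_T γ_W ≤ 1`
  have hL0 : (0 : ℝ) < F.L := by exact_mod_cast (zero_lt_one.trans F.hL.2)
  have hγ' : 0 < γ * ((F.L : ℝ)⁻¹) ^ n := mul_pos hγ (pow_pos (inv_pos.mpr hL0) n)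
  have hγ'1 : γ * ((F.L : ℝ)⁻¹) ^ n ≤ 1 := hn.trans ((min_le_left _ _).trans hγT1)
  have hFL' : (F.refine n).L = L := hFL
  obtain ⟨CT, AT, cT, hCT, hcT, hTb⟩ := hTF (F.refine n) _ hFL' hγ' (hn.trans (min_le_left _ _))
  obtain ⟨CW, AW, cW, hCW, hcW, hWb⟩ := hWF (F.refine n) _ hFL' hγ' (hn.trans (min_le_right _ _))
  -- the bare profile (landed: reflection positivity + chessboard) and the per-height constants
  obtain ⟨q₀, hq₀0, hq₀, -, hbare⟩ := bareTailAt (F.refine n) hγ' hγ'1 hb₀ hp₀1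
  obtain ⟨A'T, hA'T0, hPT⟩ := exists_perHeight_bound (F.refine n) hγ' hγ'1 hb₀ hp₀1 hCT AT hcT
  obtain ⟨A'W, hA'W0, hPW⟩ := exists_perHeight_bound (F.refine n) hγ' hγ'1 hb₀ hp₀1 hCW AW hcW
  obtain ⟨hq0, hq, -⟩ := geometric_profile (add_nonneg hA'T0 hA'W0)
  refine ⟨q₀, fun i => (A'T + A'W) * ((1 : ℝ) / 2) ^ i, hq₀0, hq₀, hq0, hq, hbare, fun K j hj1 hjK => ?_⟩
  -- one height `1 ≤ j`, `j + 2 ≤ K`: union over plaquettes, split by the conditioner, (T) + (W), arithmetic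
  haveI := isProbabilityMeasure_gibbsK (F.refine n) ℰp hγ'.le K
  refine (real_not_plaqSmall_inter_le_sum_split (gibbsK (F.refine n) ℰp (γ * ((F.L : ℝ)⁻¹) ^ n) K)
    (Averaging.iter (fun i' => BlockAveraging.blockAvg (P := (F.refine n).P K) (j := i') ℰp) j)
    (θBal (F.refine n).L (γ * ((F.L : ℝ)⁻¹) ^ n) b₀ 3 (K - j))
    {U | ∀ i, i < j → PlaqSmall (θBal (F.refine n).L (γ * ((F.L : ℝ)⁻¹) ^ n) b₀ 3 (K - i))
      (Averaging.iter (fun i' => BlockAveraging.blockAvg (P := (F.refine n).P K) (j := i') ℰp) i U)}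
    (fun U => PlaqSmall (θBal (F.refine n).L (γ * ((F.L : ℝ)⁻¹) ^ n) b₀ 3 (K - (j + 2)))
      (Averaging.iter (fun i' => BlockAveraging.blockAvg (P := (F.refine n).P K) (j := i') ℰp) (j + 2) U))).trans ?_
  refine (Finset.sum_le_sum fun a _ => add_le_add (hTb K j hj1 hjK a) (hWb K j hj1 hjK a)).trans ?_
  rw [Finset.sum_const, Finset.card_univ, nsmul_eq_mul]
  exact level_arith (card_plaq_le_pow (F.refine n) (by omega))
    (mul_nonneg (mul_nonneg hCT (pow_nonneg ((F.refine n).scheme_β_nonneg ℰp hγ'.le (K - j)) AT)) (Real.exp_nonneg _))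
    (mul_nonneg (mul_nonneg hCW (pow_nonneg ((F.refine n).scheme_β_nonneg ℰp hγ'.le (K - j)) AW)) (Real.exp_nonneg _))
    (hPT (K - j)) (hPW (K - j))

end FibreConvexity

/-! ## §5 r3 BY NAME from the crux of route `CoarseStiffnessTail` -/

section CoarseStiffness

/-- **r3 ⇐ `CappedCoarseStiffnessL`** (crux stmt-QuantumFields-25301 of route `CoarseStiffnessTail`): the capped coarse stiffness gives, by
the landed `perPlaquette_of_cappedStiffness` (chessboard `chessboardRP_T3` + exponential Chebyshev, `βθ² = p(g)²`), the plain per-plaquette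
tail with `(F, γ)`-dependent constants at the profile `(b₀, p₀) = (1, 3)` and the crux's threshold `γ₁ ≤ 1`, hence
`LargeFieldMassRefinementTail` by the landed `largeFieldMassRefinementTail_of_perPlaquette`.  The crux is not proved here; no rung or summit
is proved. [cite: FrohlichIsraelLiebSimon1978, Thm 4.1] -/
theorem largeFieldMassRefinementTail_of_cappedCoarseStiffness
    (hS : Summit.QuantumFields.YangMills.Theses.CoarseStiffnessTail.CappedCoarseStiffnessL) :
    Summit.QuantumFields.YangMills.Theses.SmallFieldWidening.LargeFieldMassRefinementTail :=
  largeFieldMassRefinementTail_of_perPlaquette fun L => by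
    obtain ⟨c₀, C₀, γ₁, hc₀, hγ₁, hγ₁1, hbound⟩ := hS L 1 3 one_pos (by norm_num)
    refine ⟨1, 3, γ₁, one_pos, by norm_num, hγ₁, hγ₁1, fun F γ hFL hγ hle => ?_⟩
    exact ⟨Real.exp (9000 * (F.L : ℝ) ^ 3 * |C₀|), 0, c₀, (Real.exp_pos _).le, hc₀,
      perPlaquette_of_cappedStiffness F hγ (hle.trans hγ₁1) one_pos hc₀ fun K j hjK => hbound F γ hFL hγ hle K j hjK⟩

end CoarseStiffness

/-! ## §6 The weakest per-plaquette currency accepted here: a FINEST-BAD-LEVEL tail with `(F, γ)`-dependent constants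

(appended, gen 20) — strictly weaker as a hypothesis than the plain per-plaquette schema of `largeFieldMassRefinementTail_of_perPlaquette`
(the event is intersected with «every finer height small», and only heights `j + 2 ≤ K` are asked); implied by `TwoSidedTailL ∧ TowerTailL`
(sum of the two conditioner statuses, §4), by `OneStepWindowL ∧ FirstExitWindowTailL` of route `FirstExitWindow` (companion file
`…OfFirstExit`), and by any lane that pays the large field only at its FIRST bad level, i.e. inside the hierarchically-small-field region. -/

section FinestBadPerPlaquette

/-- One height, no conditioner split: for a finite measure `μ`, any map `Φ` to height-`j` fields and any event `B`,
`μ({¬PlaqSmall θ (Φ y)} ∩ B) ≤ Σ_a μ({θ ≤ |Φ(y)(∂a) − 1|} ∩ B)` (union bound over the plaquettes). [cite: Balaban1985UV3, (7) p.257] -/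
theorem real_not_plaqSmall_inter_le_sum {G : Type*} [GaugeGroup G] {Y : Type*} [MeasurableSpace Y] (μ : Measure Y)
    [IsFiniteMeasure μ] {P : Params} {j : ℕ} (Φ : Y → GaugeField P j G) (θ : ℝ) (B : Set Y) :
    μ.real ({y | ¬ PlaqSmall θ (Φ y)} ∩ B) ≤
      ∑ a : Plaq P j, μ.real ({y | θ ≤ GaugeGroup.dist1 (GaugeField.plaqHol (Φ y) a)} ∩ B) := by
  have hset : {y | ¬ PlaqSmall θ (Φ y)} ∩ B ⊆
      ⋃ a : Plaq P j, ({y | θ ≤ GaugeGroup.dist1 (GaugeField.plaqHol (Φ y) a)} ∩ B) := by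
    intro y hy
    obtain ⟨h1, h2⟩ := hy
    simp only [PlaqSmall, Set.mem_setOf_eq, not_forall, not_lt] at h1
    obtain ⟨a, ha⟩ := h1
    exact Set.mem_iUnion.mpr ⟨a, ha, h2⟩
  exact (measureReal_mono hset (measure_ne_top _ _)).trans (measureReal_iUnion_fintype_le _)

/-- **r3 ⇐ A FINEST-BAD-LEVEL PER-PLAQUETTE TAIL WITH CONSTANTS DEPENDING ON THE FAMILY AND THE COUPLING** (CERTIFICATE; the weakest
per-plaquette currency of this file): for every `L` a profile `(b₀, p₀)` and a threshold `γ₁ ≤ 1` such that every `F` with `F.L = L` and every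
`0 < γ ≤ γ₁` admit `C(F,γ) ≥ 0`, `A(F,γ)`, `c(F,γ) > 0` with
`Gibbs_K({θ(K−j) ≤ |Ū^{j}(∂p) − 1|} ∩ {∀ i < j, PlaqSmall θ(K−i) (Ū^{i})}) ≤ C·β_{K−j}^A·e^{−c·p(g_{K−j})²}` for all `K`, all heights `1 ≤ j`,
`j + 2 ≤ K` and all level-`j` plaquettes `p` — the large field is paid only at the FIRST bad level, every finer block field being small — then
`LargeFieldMassRefinementTail` holds: for the ONE family `F.refine n` at an admissible depth the bare term is `bareTailAt`, the union over the
level-`j` plaquettes and `perHeight_bound` give a geometric finest-bad-level profile, and `exists_null_mass_bound_of_bare_finestBad` (§3) gives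
the null sequence.  No such tail is proved here. [cite: Balaban1985UV3, (7) p.257 and (71) p.273] -/
theorem largeFieldMassRefinementTail_of_finestBadPerPlaquette
    (h : ∀ L : ℕ, ∃ b₀ p₀ γ₁ : ℝ, 0 < b₀ ∧ 2 < p₀ ∧ 0 < γ₁ ∧ γ₁ ≤ 1 ∧
      ∀ (F : T3Family) (γ : ℝ), F.L = L → 0 < γ → γ ≤ γ₁ →
        ∃ (C : ℝ) (A : ℕ) (c : ℝ), 0 ≤ C ∧ 0 < c ∧
          ∀ (K j : ℕ), 1 ≤ j → j + 2 ≤ K → ∀ p : Plaq (F.P K) j,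
            (gibbsK F ℰp γ K).real
                ({U | θBal F.L γ b₀ p₀ (K - j) ≤
                    GaugeGroup.dist1 (GaugeField.plaqHol
                      (Averaging.iter (fun i => BlockAveraging.blockAvg (P := F.P K) (j := i) ℰp) j U) p)} ∩
                  {U | ∀ i, i < j → PlaqSmall (θBal F.L γ b₀ p₀ (K - i))
                    (Averaging.iter (fun i' => BlockAveraging.blockAvg (P := F.P K) (j := i') ℰp) i U)}) ≤
              C * (F.scheme ℰp γ).β (K - j) ^ A *
                Real.exp (-(c * B10.pFun b₀ p₀ (Real.sqrt (γ * ((F.L : ℝ)⁻¹) ^ (K - j))) ^ 2))) :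
    Summit.QuantumFields.YangMills.Theses.SmallFieldWidening.LargeFieldMassRefinementTail := by
  intro L
  obtain ⟨b₀, p₀, γ₁, hb₀, hp₀, hγ₁, hγ₁1, H⟩ := h L
  have hp₀1 : 1 ≤ p₀ := by linarith
  refine ⟨b₀, p₀, γ₁, hb₀, hp₀, hγ₁, fun F γ hFL hγ => ?_⟩
  refine exists_null_mass_bound_of_bare_finestBad F hγ fun n hn => ?_
  -- the ONE family `F.refine n` at `γ' = γL^{-n} ≤ γ₁ ≤ 1`
  have hL0 : (0 : ℝ) < F.L := by exact_mod_cast (zero_lt_one.trans F.hL.2)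
  have hγ' : 0 < γ * ((F.L : ℝ)⁻¹) ^ n := mul_pos hγ (pow_pos (inv_pos.mpr hL0) n)
  have hγ'1 : γ * ((F.L : ℝ)⁻¹) ^ n ≤ 1 := hn.trans hγ₁1
  have hFL' : (F.refine n).L = L := hFL
  obtain ⟨C, A, c, hC, hc, hb⟩ := H (F.refine n) _ hFL' hγ' hn
  obtain ⟨q₀, hq₀0, hq₀, -, hbare⟩ := bareTailAt (F.refine n) hγ' hγ'1 hb₀ hp₀1
  obtain ⟨A', hA'0, hP⟩ := exists_perHeight_bound (F.refine n) hγ' hγ'1 hb₀ hp₀1 hC A hc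
  obtain ⟨hq0, hq, -⟩ := geometric_profile hA'0
  refine ⟨q₀, fun i => A' * ((1 : ℝ) / 2) ^ i, hq₀0, hq₀, hq0, hq, hbare, fun K j hj1 hjK => ?_⟩
  -- one height `1 ≤ j`, `j + 2 ≤ K`: union over the level-`j` plaquettes, the hypothesis, the per-height arithmetic
  haveI := isProbabilityMeasure_gibbsK (F.refine n) ℰp hγ'.le K
  refine (real_not_plaqSmall_inter_le_sum (gibbsK (F.refine n) ℰp (γ * ((F.L : ℝ)⁻¹) ^ n) K)
    (Averaging.iter (fun i' => BlockAveraging.blockAvg (P := (F.refine n).P K) (j := i') ℰp) j)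
    (θBal (F.refine n).L (γ * ((F.L : ℝ)⁻¹) ^ n) b₀ p₀ (K - j))
    {U | ∀ i, i < j → PlaqSmall (θBal (F.refine n).L (γ * ((F.L : ℝ)⁻¹) ^ n) b₀ p₀ (K - i))
      (Averaging.iter (fun i' => BlockAveraging.blockAvg (P := (F.refine n).P K) (j := i') ℰp) i U)}).trans ?_
  refine (Finset.sum_le_sum fun a _ => hb K j hj1 hjK a).trans ?_
  rw [Finset.sum_const, Finset.card_univ, nsmul_eq_mul]
  refine (mul_le_mul_of_nonneg_right (card_plaq_le_pow (F.refine n) (by omega)) ?_).trans (hP (K - j))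
  exact mul_nonneg (mul_nonneg hC (pow_nonneg ((F.refine n).scheme_β_nonneg ℰp hγ'.le (K - j)) A)) (Real.exp_nonneg _)

end FinestBadPerPlaquette

end Summit.QuantumFields.YangMills.Theorems.LargeFieldMassRefinementTailOfTailRoutes

end
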